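import Summits.QuantumFields.BalabanUV.Beta.LoopIncrement
import Mathlib.Analysis.Meromorphic.FactorizedRational
import Mathlib.Topology.Perfect

/-!
# Beta / StripArgumentPrinciple — THE ONE-VARIABLE ARGUMENT PRINCIPLE ON A PERIOD STRIP, zero-freeness direction
# (β sub-cell, BINDER-OWNERS row CAP-k, lineage `b2b-balaban-beta-an5`, gen 23; node BETA-an5-g23-THEOREM-DB, leaf 2b; journal CLAIM l.14161)

THE ONE-COORDINATE CASE OF THEOREM DB (CAP-KERNEL §4.8 (xi)).  Let `f : ℂ → ℂ` be `2π`-periodic, continuous on the closed strip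
`|Im z| ≤ a` and holomorphic on the open strip (exactly the slice data of `TubeMaximumModulus.TubeHol` at width `a`), zero-free on
the two boundary lines `Im z = ±a`, and suppose the increments of continuous logarithms of `x ↦ f (x + ia)` and `x ↦ f (x − ia)` over a
period agree (equal «windings», `WindingIncrement.IsContLog`).  THEN `f` has no zero on the closed strip (`ne_zero_of_strip`).

PROOF (kernel, [folklore]).  If `f z₀ = 0`: no germ of `f` vanishes identically (identity theorem on the preconnected open strip +
continuity up to the zero-free boundary lines); the zeros with real part near `Re z₀` form a compact set inside the open strip, so they
stay below some height `a′ < a`; a period rectangle `K = [x₀, x₀ + 2π] × [−a′, a′]` with no zero on its vertical edges and `z₀` inside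
exists (the zeros in a compact set are finite — `MeromorphicOn.divisor … |>.finiteSupport`); on `K`, Mathlib's
`MeromorphicOn.extract_zeros_poles` writes `f = (∏_{u ∈ S} (· − u)^{D u}) · g` with `g` zero-free and `D u ≥ 1` on the finite zero set
`S ∋ z₀`; by `Beta.LoopIncrement` the loop increment of `f` around `∂K` is (i) `Σ_{u∈S} D u · 2πI + 0` ((L2) + (L1) + multiplicativity)
and (ii) `Δ_bottom − Δ_top` ((L3), periodicity); the increments at heights `±a′` equal those at `±a` (families on the zero-free bands)
and those over `[x₀, x₀ + 2π]` equal those over `[−π, π]` (periodic windows) — so (ii) vanishes by hypothesis while (i) does not.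

HONEST FRAMING.  Kernel complex analysis over Mathlib; no number, no binder instance, no certificate for the cell's `k₀`.  Discharging
`BetaPertH` would make Bałaban's ultraviolet stability unconditional — NOT the continuum limit, NOT the Clay problem.  0 `sorry`, 0 cite tags.
-/

namespace Summit.QuantumFields.BalabanUV.Beta.StripArgumentPrinciple

open Complex Set Metric Filter Topology
open Summit.QuantumFields.BalabanUV.Beta.WindingIncrement
open Summit.QuantumFields.BalabanUV.Beta.LoopIncrement
open scoped Real

noncomputable section

/-! ## §1 Pointwise factorisation of an analytic function on a compact rectangle (Mathlib's `extract_zeros_poles`, read pointwise) -/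

/-- the divisor of an analytic function at a zero of finite order is positive. [folklore] -/
theorem divisor_pos_of_zero {f : ℂ → ℂ} {K : Set ℂ} (hf : AnalyticOnNhd ℂ f K) {z : ℂ} (hz : z ∈ K) (hfz : f z = 0)
    (hft : analyticOrderAt f z ≠ ⊤) : 0 < MeromorphicOn.divisor f K z := by
  obtain ⟨n, hn⟩ := ENat.ne_top_iff_exists.mp hft
  have hn0 : n ≠ 0 := by
    intro h0
    have := (hf z hz).analyticOrderAt_eq_zero.mp (by rw [← hn, h0]; rfl)
    exact this hfz
  rw [MeromorphicOn.AnalyticOnNhd.divisor_apply hf hz, ← hn]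
  simp only [ENat.map_coe, WithTop.untop₀_coe]
  exact_mod_cast Nat.pos_of_ne_zero hn0

/-- an analytic function has finite meromorphic order where its analytic order is finite. [folklore] -/
theorem meromorphicOrderAt_ne_top_of {f : ℂ → ℂ} {z : ℂ} (hf : AnalyticAt ℂ f z) (hft : analyticOrderAt f z ≠ ⊤) :
    meromorphicOrderAt f z ≠ ⊤ := by
  rw [hf.meromorphicOrderAt_eq]
  obtain ⟨n, hn⟩ := ENat.ne_top_iff_exists.mp hft
  rw [← hn]; simp

/-- **POINTWISE FACTORISATION ON A COMPACT RECTANGLE**: an analytic `f` with no identically vanishing germ on a non-degenerate closed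
rectangle `K` is, AT EVERY POINT of `K`, the finite product `∏_{u ∈ S} (z − u)^{D u}` over the (finite) support `S` of its divisor
`D` times an analytic zero-free `g` (Mathlib's codiscrete factorisation, upgraded to pointwise equality by continuity at the
accumulation points of the preperfect `K`). [folklore] -/
theorem factor_on_rect {f : ℂ → ℂ} {x₀ x₁ y₀ y₁ : ℝ} (hx : x₀ < x₁) (hy : y₀ ≤ y₁)
    (hf : AnalyticOnNhd ℂ f (Icc x₀ x₁ ×ℂ Icc y₀ y₁)) (hft : ∀ u ∈ Icc x₀ x₁ ×ℂ Icc y₀ y₁, analyticOrderAt f u ≠ ⊤) :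
    ∃ (g : ℂ → ℂ) (hS : (MeromorphicOn.divisor f (Icc x₀ x₁ ×ℂ Icc y₀ y₁)).support.Finite),
      AnalyticOnNhd ℂ g (Icc x₀ x₁ ×ℂ Icc y₀ y₁) ∧ (∀ u ∈ Icc x₀ x₁ ×ℂ Icc y₀ y₁, g u ≠ 0) ∧
      ∀ z ∈ Icc x₀ x₁ ×ℂ Icc y₀ y₁,
        f z = (∏ u ∈ hS.toFinset, (z - u) ^ MeromorphicOn.divisor f (Icc x₀ x₁ ×ℂ Icc y₀ y₁) u) * g z := by
  set K := Icc x₀ x₁ ×ℂ Icc y₀ y₁ with hK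
  have hKc : IsCompact K := isCompact_Icc.reProdIm isCompact_Icc
  -- the closed rectangle is convex (≡ `Literature…PlaneTopology.convex_Icc_reProdIm_Icc`, inlined), hence preperfect
  have hKv : Convex ℝ K := ((convex_Icc x₀ x₁).linear_preimage reLm).inter ((convex_Icc y₀ y₁).linear_preimage imLm)
  have hKp : Preperfect K := by
    refine hKv.isPreconnected.preperfect_of_nontrivial ?_
    refine ⟨(x₀ : ℂ) + y₀ * I, (mem_reProdIm_iff x₀ y₀ _ _).mpr ⟨⟨le_rfl, hx.le⟩, ⟨le_rfl, hy⟩⟩,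
      (x₁ : ℂ) + y₀ * I, (mem_reProdIm_iff x₁ y₀ _ _).mpr ⟨⟨hx.le, le_rfl⟩, ⟨le_rfl, hy⟩⟩, ?_⟩
    intro h
    have := congrArg Complex.re h
    simp at this; linarith
  set D := MeromorphicOn.divisor f K with hD
  have h₃ : D.support.Finite := D.finiteSupport hKc
  obtain ⟨g, hg, hg0, hfg⟩ := hf.meromorphicOn.extract_zeros_poles
    (fun u => meromorphicOrderAt_ne_top_of (hf u u.2) (hft u u.2)) h₃
  have hD0 : 0 ≤ D := MeromorphicOn.AnalyticOnNhd.divisor_nonneg hf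
  refine ⟨g, h₃, hg, fun u hu => hg0 ⟨u, hu⟩, fun z hz => ?_⟩
  -- the factorised function is analytic at `z`
  set P : ℂ → ℂ := ∏ᶠ u, (· - u) ^ D u with hP
  have hPa : AnalyticAt ℂ P z := Function.FactorizedRational.analyticAt (hD0 z)
  have hPg : AnalyticAt ℂ (P • g) z := hPa.smul (hg z hz)
  -- codiscrete equality ⟹ punctured-neighbourhood equality ⟹ equality at `z`
  have hev : f =ᶠ[𝓝[≠] z] (P • g) :=
    (hf z hz).meromorphicAt.eventuallyEq_nhdsNE_of_eventuallyEq_codiscreteWithin hPg.meromorphicAt hz (hKp z hz) hfg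
  have h1 : Tendsto f (𝓝[≠] z) (𝓝 (f z)) := (hf z hz).continuousAt.continuousWithinAt.tendsto
  have h2 : Tendsto (P • g) (𝓝[≠] z) (𝓝 ((P • g) z)) := hPg.continuousAt.continuousWithinAt.tendsto
  have heq : f z = (P • g) z := tendsto_nhds_unique h1 (h2.congr' hev.symm)
  rw [heq, Pi.smul_apply', smul_eq_mul, hP, Function.FactorizedRational.finprod_eq_fun h₃]
  congr 1
  refine finprod_eq_prod_of_mulSupport_subset _ fun u hu => ?_
  rw [Finite.coe_toFinset]
  by_contra hD
  have : D u = 0 := by simpa [Function.mem_support] using hD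
  exact hu (by simp [this])

/-! ## §2 The strip theorem -/

section Strip

variable {f : ℂ → ℂ} {a : ℝ}

/-- no germ of `f` vanishes identically in the open strip when `f` is continuous up to a boundary line on which it has no zero
(identity theorem on the preconnected open strip, then continuity). [folklore] -/
theorem analyticOrderAt_ne_top_of_strip (ha : 0 < a) (hc : ContinuousOn f (im ⁻¹' Icc (-a) a))
    (hd : DifferentiableOn ℂ f (im ⁻¹' Ioo (-a) a)) (htop : ∀ x : ℝ, f (x + a * I) ≠ 0) :
    ∀ u ∈ im ⁻¹' Ioo (-a) a, analyticOrderAt f u ≠ ⊤ := by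
  have hUo : IsOpen (im ⁻¹' Ioo (-a) a) := isOpen_Ioo.preimage continuous_im
  have hA : AnalyticOnNhd ℂ f (im ⁻¹' Ioo (-a) a) := (analyticOnNhd_iff_differentiableOn hUo).2 hd
  have hUc : IsPreconnected (im ⁻¹' Ioo (-a) a) := ((convex_Ioo (-a) a).linear_preimage imLm).isPreconnected
  intro u hu htop'
  have hev : f =ᶠ[𝓝 u] 0 := analyticOrderAt_eq_top.mp htop'
  have hU0 : EqOn f 0 (im ⁻¹' Ioo (-a) a) := hA.eqOn_zero_of_preconnected_of_eventuallyEq_zero hUc hu hev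
  have hcl : im ⁻¹' Icc (-a) a ⊆ closure (im ⁻¹' Ioo (-a) a) := by
    rw [closure_preimage_im, closure_Ioo (by linarith : (-a) ≠ a)]
  have hS0 : EqOn f 0 (im ⁻¹' Icc (-a) a) :=
    hU0.of_subset_closure hc continuousOn_const (preimage_mono Ioo_subset_Icc_self) hcl
  have : f ((0 : ℝ) + a * I) = 0 := hS0 (by show ((0 : ℝ) + a * I : ℂ).im ∈ Icc (-a) a; simp; linarith)
  exact htop 0 this

/-- joint continuity of `(τ, x) ↦ f (x + iτ)` on a parameter × variable rectangle inside the closed strip. [folklore] -/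
theorem continuousOn_family (hc : ContinuousOn f (im ⁻¹' Icc (-a) a)) {τ₀ τ₁ x₀ x₁ : ℝ} (hτ : Icc τ₀ τ₁ ⊆ Icc (-a) a) :
    ContinuousOn (fun p : ℝ × ℝ => f ((p.2 : ℂ) + p.1 * I)) (Icc τ₀ τ₁ ×ˢ Icc x₀ x₁) := by
  have hm : Continuous fun p : ℝ × ℝ => ((p.2 : ℂ) + p.1 * I) :=
    (continuous_ofReal.comp continuous_snd).add ((continuous_ofReal.comp continuous_fst).mul continuous_const)
  refine hc.comp hm.continuousOn fun p hp => ?_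
  show ((p.2 : ℂ) + p.1 * I).im ∈ Icc (-a) a
  simp only [add_im, ofReal_im, mul_im, ofReal_re, I_im, mul_one, I_re, mul_zero, add_zero, zero_add]
  exact hτ hp.1

/-- **THE STRIP ARGUMENT PRINCIPLE (zero-freeness direction).**  `f` `2π`-periodic, continuous on the closed strip `|Im z| ≤ a`
(`0 < a`), holomorphic on the open strip, zero-free on the lines `Im z = ±a`, and the increments over `[−π, π]` of continuous
logarithms of `x ↦ f (x + ia)` and `x ↦ f (x − ia)` agree ⟹ `f` has no zero on the closed strip. [folklore] -/
theorem ne_zero_of_strip (ha : 0 < a) (hc : ContinuousOn f (im ⁻¹' Icc (-a) a))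
    (hd : DifferentiableOn ℂ f (im ⁻¹' Ioo (-a) a)) (hper : ∀ z : ℂ, f (z + 2 * π) = f z)
    (htop : ∀ x : ℝ, f (x + a * I) ≠ 0) (hbot : ∀ x : ℝ, f (x + (-a) * I) ≠ 0)
    (hW : ∃ Lp Lm : ℝ → ℂ, IsContLog (hEdge f a) (-π) π Lp ∧ IsContLog (hEdge f (-a)) (-π) π Lm ∧
      Lp π - Lp (-π) = Lm π - Lm (-π)) :
    ∀ z : ℂ, z.im ∈ Icc (-a) a → f z ≠ 0 := by
  intro z₀ hz₀ hfz₀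
  obtain ⟨Lp, Lm, hLp, hLm, hW⟩ := hW
  -- Step 0: the zero is in the open strip
  have hbotE : ∀ x : ℝ, hEdge f (-a) x ≠ 0 := fun x => by
    have := hbot x; simpa only [hEdge_apply, ofReal_neg, neg_mul] using this
  have hz₀' : z₀.im ∈ Ioo (-a) a := by
    refine ⟨lt_of_le_of_ne hz₀.1 fun h => hbot z₀.re ?_, lt_of_le_of_ne hz₀.2 fun h => htop z₀.re ?_⟩
    · have e : ((z₀.re : ℂ) + -(a : ℂ) * I) = z₀ := Complex.ext (by simp) (by simpa using h)
      rw [e]; exact hfz₀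
    · have e : ((z₀.re : ℂ) + (a : ℂ) * I) = z₀ := Complex.ext (by simp) (by simpa using h.symm)
      rw [e]; exact hfz₀
  -- Step 1–2: analyticity on the open strip, no identically vanishing germ
  have hUo : IsOpen (im ⁻¹' Ioo (-a) a) := isOpen_Ioo.preimage continuous_im
  have hA : AnalyticOnNhd ℂ f (im ⁻¹' Ioo (-a) a) := (analyticOnNhd_iff_differentiableOn hUo).2 hd
  have hT := analyticOrderAt_ne_top_of_strip ha hc hd htop
  -- Step 3: the zeros with real part in `[Re z₀ − 2π, Re z₀ + 2π]` stay below a height `M < a`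
  set X := Icc (z₀.re - 2 * π) (z₀.re + 2 * π) with hX
  set Z := (X ×ℂ Icc (-a) a) ∩ f ⁻¹' {0} with hZ
  have hZc : IsCompact Z := by
    refine (isCompact_Icc.reProdIm isCompact_Icc).of_isClosed_subset ?_ inter_subset_left
    exact (hc.mono fun z hz => (mem_reProdIm.mp hz).2).preimage_isClosed_of_isClosed
      (isClosed_Icc.reProdIm isClosed_Icc) isClosed_singleton
  have hz₀Z : z₀ ∈ Z := ⟨mem_reProdIm.mpr ⟨⟨by linarith [Real.pi_pos], by linarith [Real.pi_pos]⟩, hz₀⟩, hfz₀⟩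
  obtain ⟨zs, hzs, hmax⟩ := hZc.exists_isMaxOn ⟨z₀, hz₀Z⟩ (continuous_abs.comp continuous_im).continuousOn
  set M := |zs.im| with hM
  have hMa : M < a := by
    have hzs1 : zs.im ∈ Icc (-a) a := (mem_reProdIm.mp hzs.1).2
    have hfzs : f zs = 0 := hzs.2
    rw [hM, abs_lt]
    constructor
    · refine lt_of_le_of_ne hzs1.1 fun h => hbot zs.re ?_
      have e : ((zs.re : ℂ) + -(a : ℂ) * I) = zs := Complex.ext (by simp) (by simpa using h)
      rw [e]; exact hfzs
    · refine lt_of_le_of_ne hzs1.2 fun h => htop zs.re ?_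
      have e : ((zs.re : ℂ) + (a : ℂ) * I) = zs := Complex.ext (by simp) (by simpa using h.symm)
      rw [e]; exact hfzs
  have hM0 : 0 ≤ M := abs_nonneg _
  have hzero_le : ∀ z, z.re ∈ X → z.im ∈ Icc (-a) a → f z = 0 → |z.im| ≤ M := fun z hzr hzi hfz =>
    hmax (show z ∈ Z from ⟨mem_reProdIm.mpr ⟨hzr, hzi⟩, hfz⟩)
  -- the height `a′`
  set a' := (M + a) / 2 with ha'
  have hMa' : M < a' := by rw [ha']; linarith
  have ha'a : a' < a := by rw [ha']; linarith
  have ha'0 : 0 < a' := lt_of_le_of_lt hM0 hMa'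
  have hsub' : Icc (-a') a' ⊆ Ioo (-a) a := fun y hy => ⟨by linarith [hy.1], by linarith [hy.2]⟩
  have hnz : ∀ z, z.re ∈ X → z.im ∈ Icc (-a) a → a' ≤ |z.im| → f z ≠ 0 := fun z hzr hzi hzi' hfz =>
    absurd ((hzero_le z hzr hzi hfz).trans_lt hMa') (not_lt.mpr hzi')
  -- Step 4: finitely many zeros in `C = X × [−a′, a′]`; an abscissa `x₀ ∈ (Re z₀ − 2π, Re z₀)` carrying no zero
  set C := X ×ℂ Icc (-a') a' with hC
  have hCU : C ⊆ im ⁻¹' Ioo (-a) a := fun z hz => hsub' (mem_reProdIm.mp hz).2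
  have hAC : AnalyticOnNhd ℂ f C := hA.mono hCU
  have hfinC : ((C ∩ f ⁻¹' {0})).Finite := by
    refine ((MeromorphicOn.divisor f C).finiteSupport (isCompact_Icc.reProdIm isCompact_Icc)).subset ?_
    intro u hu
    exact Function.mem_support.mpr (divisor_pos_of_zero hAC hu.1 hu.2 (hT u (hCU hu.1))).ne'
  have hbad : ((fun u : ℂ => u.re) '' (C ∩ f ⁻¹' {0})).Finite := hfinC.image _
  obtain ⟨x₀, hx₀I, hx₀bad⟩ := ((Ioo_infinite (by linarith [Real.pi_pos] : z₀.re - 2 * π < z₀.re)).sdiff hbad).nonempty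
  set x₁ := x₀ + 2 * π with hx₁
  have hx₀₁ : x₀ < x₁ := by rw [hx₁]; linarith [Real.pi_pos]
  have hXsub : Icc x₀ x₁ ⊆ X := fun x hx => ⟨by linarith [hx.1, hx₀I.1], by linarith [hx.2, hx₀I.2, Real.pi_pos]⟩
  have hleft : ∀ y ∈ Icc (-a') a', f ((x₀ : ℂ) + y * I) ≠ 0 := by
    intro y hy hfy
    refine hx₀bad ⟨(x₀ : ℂ) + y * I, ⟨(mem_reProdIm_iff x₀ y _ _).mpr ⟨hXsub ⟨le_rfl, hx₀₁.le⟩, hy⟩, hfy⟩, by simp⟩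
  have hperE : ∀ y : ℝ, f ((x₁ : ℂ) + y * I) = f ((x₀ : ℂ) + y * I) := by
    intro y; rw [hx₁, ← hper ((x₀ : ℂ) + y * I)]; push_cast; ring_nf
  -- Step 5: factorisation on `K = [x₀, x₁] × [−a′, a′]`
  set K := Icc x₀ x₁ ×ℂ Icc (-a') a' with hKdef
  have hKC : K ⊆ C := fun z hz => mem_reProdIm.mpr ⟨hXsub (mem_reProdIm.mp hz).1, (mem_reProdIm.mp hz).2⟩
  have hAK : AnalyticOnNhd ℂ f K := hAC.mono hKC
  have ha'' : -a' ≤ a' := by linarith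
  obtain ⟨g, hS, hg, hg0, hfac⟩ := factor_on_rect hx₀₁ ha'' hAK fun u hu => hT u (hCU (hKC hu))
  set D := MeromorphicOn.divisor f K with hDdef
  set S := hS.toFinset with hSdef
  -- every `u ∈ S` is a zero of `f` in the INTERIOR of `K`
  have hSint : ∀ u ∈ S, x₀ < u.re ∧ u.re < x₁ ∧ -a' < u.im ∧ u.im < a' := by
    intro u hu
    have huS : u ∈ D.support := by simpa [hSdef] using hu
    have huK : u ∈ K := D.supportWithinDomain huS
    have hDu : D u ≠ 0 := Function.mem_support.mp huS
    have hfu : f u = 0 := by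
      by_contra hne
      have h0 : analyticOrderAt f u = 0 := (hAK u huK).analyticOrderAt_eq_zero.mpr hne
      apply hDu
      rw [hDdef, MeromorphicOn.AnalyticOnNhd.divisor_apply hAK huK, h0]; simp
    obtain ⟨⟨hr0, hr1⟩, ⟨hi0, hi1⟩⟩ := mem_reProdIm.mp huK
    have e : u = (u.re : ℂ) + u.im * I := (re_add_im u).symm
    refine ⟨lt_of_le_of_ne hr0 ?_, lt_of_le_of_ne hr1 ?_, lt_of_le_of_ne hi0 ?_, lt_of_le_of_ne hi1 ?_⟩
    · intro h; exact hleft u.im ⟨hi0, hi1⟩ (by rw [h, ← e]; exact hfu)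
    · intro h; exact hleft u.im ⟨hi0, hi1⟩ (by rw [← hperE, ← h, ← e]; exact hfu)
    · intro h
      exact hnz u (hXsub ⟨hr0, hr1⟩) ⟨by linarith, by linarith⟩ (by rw [← h, abs_neg, abs_of_pos ha'0]) hfu
    · intro h
      exact hnz u (hXsub ⟨hr0, hr1⟩) ⟨by linarith, by linarith⟩ (by rw [h, abs_of_pos ha'0]) hfu
  -- `z₀ ∈ S`, all multiplicities positive
  have hz₀M : |z₀.im| ≤ M := hzero_le z₀ (mem_reProdIm.mp hz₀Z.1).1 hz₀ hfz₀
  have hz₀K : z₀ ∈ K := mem_reProdIm.mpr ⟨⟨hx₀I.2.le, by rw [hx₁]; linarith [hx₀I.1]⟩,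
    ⟨by linarith [(abs_le.mp hz₀M).1], by linarith [(abs_le.mp hz₀M).2]⟩⟩
  have hDpos : ∀ u ∈ S, 0 < D u := by
    intro u hu
    have huS : u ∈ D.support := by simpa [hSdef] using hu
    exact lt_of_le_of_ne (MeromorphicOn.AnalyticOnNhd.divisor_nonneg hAK u) (Ne.symm (Function.mem_support.mp huS))
  have hz₀S : z₀ ∈ S := by
    have : 0 < D z₀ := divisor_pos_of_zero hAK hz₀K hfz₀ (hT z₀ hz₀')
    simpa [hSdef, Function.mem_support] using this.ne'
  have hsum_pos : 0 < ∑ u ∈ S, D u := Finset.sum_pos hDpos ⟨z₀, hz₀S⟩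
  -- Step 6 (i): the loop increment of `f` around `∂K` is `Σ_{u∈S} D u · 2πI + 0`
  have hP : HasLoopIncr (fun z => ∏ u ∈ S, (z - u) ^ D u) x₀ x₁ (-a') a' (∑ u ∈ S, (D u : ℂ) * (2 * π * I)) :=
    HasLoopIncr.prod S fun u hu => by
      obtain ⟨h1, h2, h3, h4⟩ := hSint u hu
      exact (hasLoopIncr_sub_const h1 h2 h3 h4).zpow (D u)
  have hgK : ContinuousOn g K := hg.continuousOn
  have hG : HasLoopIncr g x₀ x₁ (-a') a' 0 := hasLoopIncr_zero_of_ne_zero hx₀₁.le ha'' hgK hg0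
  have hF1 : HasLoopIncr f x₀ x₁ (-a') a' (∑ u ∈ S, (D u : ℂ) * (2 * π * I) + 0) :=
    (hP.mul hG).congr (fun z hz => hfac z hz) hx₀₁.le ha''
  -- Step 6 (ii): it is also `Δ_bottom − Δ_top` at heights `∓a′`
  have hKsub : K ⊆ im ⁻¹' Icc (-a) a := fun z hz => Ioo_subset_Icc_self (hCU (hKC hz))
  have hcK : ContinuousOn f K := hc.mono hKsub
  have hbot' : ∀ x ∈ Icc x₀ x₁, hEdge f (-a') x ≠ 0 := fun x hx =>
    hnz _ (hXsub (by simpa using hx)) (by simp; constructor <;> linarith) (by simp [abs_of_pos ha'0])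
  have htop' : ∀ x ∈ Icc x₀ x₁, hEdge f a' x ≠ 0 := fun x hx =>
    hnz _ (hXsub (by simpa using hx)) (by simp; constructor <;> linarith) (by simp [abs_of_pos ha'0])
  obtain ⟨Lb, hLb⟩ := exists_isContLog (continuousOn_hEdge hcK ⟨le_rfl, ha''⟩) hbot'
  obtain ⟨Lt, hLt⟩ := exists_isContLog (continuousOn_hEdge hcK ⟨ha'', le_rfl⟩) htop'
  have hperK : ∀ z : ℂ, f (z + (x₁ - x₀ : ℝ)) = f z := by
    intro z; rw [hx₁, show ((x₀ + 2 * π - x₀ : ℝ) : ℂ) = 2 * π by push_cast; ring]; exact hper z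
  have hF2 : HasLoopIncr f x₀ x₁ (-a') a' ((Lb x₁ - Lb x₀) - (Lt x₁ - Lt x₀)) :=
    hasLoopIncr_of_periodic ha'' hperK hLb hLt (continuousOn_vEdge hcK ⟨le_rfl, hx₀₁.le⟩)
      fun y hy => hleft y hy
  have hEq : (Lb x₁ - Lb x₀) - (Lt x₁ - Lt x₀) = ∑ u ∈ S, (D u : ℂ) * (2 * π * I) + 0 :=
    hF2.unique hF1 hx₀₁.le ha''
  -- Step 7: the increments at heights `±a′` equal those at `±a` (families on the zero-free bands)
  obtain ⟨Lp', hLp'⟩ := exists_isContLog (s := x₀) (t := x₁) (φ := hEdge f a)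
    (continuousOn_hEdge (y₀ := -a) (y₁ := a) (hc.mono fun z hz => (mem_reProdIm.mp hz).2) ⟨by linarith, le_rfl⟩)
    fun x _ => htop x
  obtain ⟨Lm', hLm'⟩ := exists_isContLog (s := x₀) (t := x₁) (φ := hEdge f (-a))
    (continuousOn_hEdge (y₀ := -a) (y₁ := a) (hc.mono fun z hz => (mem_reProdIm.mp hz).2) ⟨le_rfl, by linarith⟩)
    fun x _ => hbotE x
  have hTopBand : Lt x₁ - Lt x₀ = Lp' x₁ - Lp' x₀ := by
    refine incr_eq_of_family (F := fun τ x => f ((x : ℂ) + τ * I)) (τ₀ := a') (τ₁ := a) hx₀₁.le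
      (continuousOn_family hc fun y hy => ⟨by linarith [hy.1], hy.2⟩) ?_ ?_ ⟨le_rfl, ha'a.le⟩ ⟨ha'a.le, le_rfl⟩ hLt hLp'
    · intro τ hτ x hx
      exact hnz _ (by simpa using hXsub hx) (by simp; constructor <;> linarith [hτ.1, hτ.2])
        (by simp; rw [abs_of_pos (lt_of_lt_of_le ha'0 hτ.1)]; exact hτ.1)
    · intro τ _; exact hperE τ
  have hBotBand : Lb x₁ - Lb x₀ = Lm' x₁ - Lm' x₀ := by
    refine (incr_eq_of_family (F := fun τ x => f ((x : ℂ) + τ * I)) (τ₀ := -a) (τ₁ := -a') hx₀₁.le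
      (continuousOn_family hc fun y hy => ⟨hy.1, by linarith [hy.2]⟩) ?_ ?_ ⟨by linarith, le_rfl⟩ ⟨le_rfl, by linarith⟩
      hLb hLm')
    · intro τ hτ x hx
      exact hnz _ (by simpa using hXsub hx) (by simp; constructor <;> linarith [hτ.1, hτ.2])
        (by simp; rw [abs_of_neg (by linarith [hτ.2])]; linarith [hτ.2])
    · intro τ _; exact hperE τ
  -- Step 8: periodic windows move `[x₀, x₀ + 2π]` to `[−π, π]`
  have hcontE : ∀ y ∈ Icc (-a) a, Continuous (hEdge f y) := fun y hy =>
    hc.comp_continuous (continuous_hLine y) fun x => by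
      show ((x : ℂ) + y * I).im ∈ Icc (-a) a; simpa using hy
  have hperE' : ∀ y x : ℝ, hEdge f y (x + 2 * π) = hEdge f y x := by
    intro y x; simp only [hEdge_apply]; rw [← hper ((x : ℂ) + y * I)]; push_cast; ring_nf
  have e1 : (-π : ℝ) + 2 * π = π := by ring
  have hTopW : Lp' (x₀ + 2 * π) - Lp' x₀ = Lp (-π + 2 * π) - Lp (-π) :=
    incr_eq_of_periodic (by linarith [Real.pi_pos]) (hcontE a ⟨by linarith, le_rfl⟩) (fun x => htop x) (hperE' a)
      (by rw [← hx₁]; exact hLp') (by rw [e1]; exact hLp)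
  have hBotW : Lm' (x₀ + 2 * π) - Lm' x₀ = Lm (-π + 2 * π) - Lm (-π) :=
    incr_eq_of_periodic (by linarith [Real.pi_pos]) (hcontE (-a) ⟨le_rfl, by linarith⟩) (fun x => hbotE x) (hperE' (-a))
      (by rw [← hx₁]; exact hLm') (by rw [e1]; exact hLm)
  rw [e1, ← hx₁] at hTopW hBotW
  -- conclusion
  have hzero : ∑ u ∈ S, (D u : ℂ) * (2 * π * I) = 0 := by
    have := hEq
    rw [hTopBand, hBotBand, hTopW, hBotW, hW, sub_self, add_zero] at this
    exact this.symm
  rw [← Finset.sum_mul] at hzero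
  have h2pi : (2 * π * I : ℂ) ≠ 0 := by simp [Real.pi_ne_zero]
  have hs0 : (∑ u ∈ S, (D u : ℂ)) = 0 := (mul_eq_zero.mp hzero).resolve_right h2pi
  have : ((∑ u ∈ S, D u : ℤ) : ℂ) = 0 := by push_cast; exact hs0
  exact absurd (by exact_mod_cast this) hsum_pos.ne'

end Strip

end

end Summit.QuantumFields.BalabanUV.Beta.StripArgumentPrinciple
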